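import Summits.AtomisticToContinuum.FouriersLaw.Theorems.BondHeatUncertaintyExtensiveSnapshotIrreversibilityEnergyWindowArrivalGlueA

/-!
# Energy window, part W-3 — the ARRIVAL GLUE — file 2 of 2 (sequel of `…BondHeatUncertaintyExtensiveSnapshotIrreversibilityEnergyWindowArrivalGlueA`)

Split for the 400-line cap; the module docstring of file 1 describes the whole part.
This file holds the path-level arrival bound `abs_integral_partialP_comp_le` and §3 the glue.
Same namespace, same section variables; no instance / notation / option; no proof holes.
[folklore]
-/

noncomputable section

namespace Summit.AtomisticToContinuum.FouriersLaw.Theorems.ExtensiveSnapshotIrreversibility.EnergyWindow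

open MeasureTheory ProbabilityTheory Filter Topology Set
open scoped ENNReal NNReal Matrix ContDiff
open Literature.MathematicalPhysics.KineticTheory.HeatConduction
open Literature.MathematicalPhysics.KineticTheory
open Literature.Probability.Process

section Arrival

variable {ω₂ lam β γ : ℝ} (hω : 0 < ω₂) (hl : 0 < lam) (hβ : 0 < β) (hγ : 0 < γ) {N : ℕ}
  (hN : 0 < N) {T T_L T_R : ℝ} (hT : 0 < T) (hTL : T / 2 ≤ T_L) (hTL' : T_L ≤ 2 * T)
  (hTR : T / 2 ≤ T_R) (hTR' : T_R ≤ 2 * T)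

include hω hl hβ hγ hN hT hTL hTL' hTR hTR' in
/-- ★ **Path-level arrival bound** (baths in `[T/2, 2T]`, `0 < s ≤ 1`, `g ∈ C¹_c`):
if `E|g(E_m)|^p ≤ A₁^p` at every level and the regularised arrival weights have `q`-th moments
`≤ A₂^q` eventually in the level for every `κ > 0` ((SWM)-shape), then
`|E[∂_{p_b} g(E_m)]| ≤ A₁ A₂` — by the arrival identity, Hölder, and the vanishing defect
((I-s2)ₛ pointwise, W-0). [folklore] -/
theorem abs_integral_partialP_comp_le (hJ2 : SkeletonSecondVariationMoments) {p q : ℝ}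
    (hpq : p.HolderConjugate q) {s : ℝ} (hs : s ∈ Icc (0 : ℝ) 1) (b : Fin N) (z : PhaseSpace N)
    (hsurj : ∀ wp : WienerPair, ∃ m₀ : ℕ, ∀ m, m₀ ≤ m → LinearMap.range
      (fderiv ℝ (skelFlowMapAt ω₂ lam β γ N T_L T_R s m z (pairRem m wp)) (pairSkel m wp) :
        PairSkeleton m →ₗ[ℝ] PhaseSpace N) = ⊤)
    {g : PhaseSpace N → ℝ} (hg : ContDiff ℝ 1 g) (hgc : HasCompactSupport g) {A₁ A₂ : ℝ}
    (hA₁ : 0 ≤ A₁) (hA₂ : 0 ≤ A₂)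
    (h1 : ∀ m : ℕ, ∫⁻ wp, ENNReal.ofReal |g (skelFlowMapAt ω₂ lam β γ N T_L T_R s m z
        (pairRem m wp) (pairSkel m wp))| ^ p ∂wienerPair ≤ ENNReal.ofReal (A₁ ^ p))
    (h2 : ∀ κ : ℝ, 0 < κ → ∃ m₁ : ℕ, ∀ m : ℕ, m₁ ≤ m →
        skelMoment m q (skelWeightArr ω₂ lam β γ N T_L T_R s m κ b z) ≤ ENNReal.ofReal (A₂ ^ q))
    (m : ℕ) :
    |∫ wp, partialP b g (skelFlowMapAt ω₂ lam β γ N T_L T_R s m z (pairRem m wp) (pairSkel m wp))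
        ∂wienerPair| ≤ A₁ * A₂ := by
  -- bounds on `g` and `Dg`
  obtain ⟨M₀, hM₀⟩ := hg.continuous.bounded_above_of_compact_support hgc
  have hgM : ∀ w, |g w| ≤ M₀ := fun w => by rw [← Real.norm_eq_abs]; exact hM₀ w
  obtain ⟨L₀, hL₀⟩ := (hg.continuous_fderiv one_ne_zero).bounded_above_of_compact_support
    (hgc.fderiv (𝕜 := ℝ))
  have hL : 0 ≤ max L₀ 0 := le_max_right _ _
  have hgL : ∀ w v, |fderiv ℝ g w v| ≤ max L₀ 0 * ‖v‖ := fun w v => by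
    rw [← Real.norm_eq_abs]
    exact (fderiv ℝ g w).le_of_opNorm_le ((hL₀ w).trans (le_max_left _ _)) v
  -- the left side does not depend on the level
  have hlev : ∀ k : ℕ, ∫ wp, partialP b g (skelFlowMapAt ω₂ lam β γ N T_L T_R s k z (pairRem k wp)
      (pairSkel k wp)) ∂wienerPair = ∫ wp, partialP b g ((pinnedChain ω₂ lam β γ).solMap N T_L T_R
        s z (pairPath wp)) ∂wienerPair := by
    intro k
    congr 1
    funext wp
    rw [pinnedChain_solMap_eq_skelFlowMapAt hω hl.le hβ.le hγ.le N T_L T_R hs k z wp]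
  refine le_of_forall_pos_le_add fun ε hε => ?_
  -- the defect level `n`
  have hLp : 0 < max L₀ 0 + 1 := add_pos_of_nonneg_of_pos hL one_pos
  have hη : 0 < ε / (max L₀ 0 + 1) := div_pos hε hLp
  have heI : ∫⁻ _ : WienerPair, ENNReal.ofReal (√(momCoord N b ⬝ᵥ momCoord N b)) ∂wienerPair ≠ ⊤ := by
    rw [lintegral_const]
    exact ENNReal.mul_ne_top ENNReal.ofReal_ne_top (measure_ne_top _ _)
  obtain ⟨n, hn⟩ := exists_lintegral_sqrt_defectSq_le hω hl.le hβ.le hγ.le N T_L T_R hs z hsurj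
    (e := fun _ => momCoord N b) (fun a => measurable_const) heI hη
  have hκ : 0 < ((n : ℝ) + 1)⁻¹ := inv_natCast_succ_pos n
  obtain ⟨m₁, hm₁⟩ := h2 _ hκ
  -- work at the level `m' = max n m₁`
  rw [hlev m, ← hlev (max n m₁)]
  have hId := integral_mul_skelWeightArr_eq hω hl.le hβ.le hγ.le N T_L T_R hs (max n m₁) hκ b z hg
    (fun j => integrable_mul_skelFieldArr hω hl hβ hγ hN hT hTL hTL' hTR hTR' hs _ hκ b z hg hgM j)
    (fun j => integrable_coordX_mul_mul_skelFieldArr hω hl hβ hγ hN hT hTL hTL' hTR hTR' hs _ hκ b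
      z hg hgM j)
    (fun j => integrable_fderiv_comp_mul_skelFieldArr hω hl hβ hγ hN hT hTL hTL' hTR hTR' hs _ hκ b
      z hg hgL j)
    (fun j => integrable_mul_fderiv_skelFieldArr hω hl hβ hγ hN hT hTL hTL' hTR hTR' hJ2 hs _ hκ b
      z hg hgM j)
  rw [integral_sub (integrable_partialP_comp_path hω hl hβ hγ s _ b z hg hgL)
    (integrable_defectTerm hω hl hβ hγ hs z b hg hL hgL (le_max_left n m₁))] at hId
  have hHol := abs_integral_mul_le_of_holder wienerPair hpq
    (measurable_comp_skelFlowMapAt_path hω hl hβ hγ s (max n m₁) z hg.continuous)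
    (measurable_skelWeightArr_path hω hl hβ hγ hs (max n m₁) hκ b z) hA₁ hA₂ (h1 _)
    (hm₁ _ (le_max_right _ _))
  have hDef := abs_integral_defectTerm_le hω hl hβ hγ hs (max n m₁) z b hL hgL (le_max_left n m₁)
    hη.le hn
  have hLε : max L₀ 0 * (ε / (max L₀ 0 + 1)) ≤ ε := by
    rw [mul_div_assoc', div_le_iff₀ hLp]
    nlinarith [hL, hε.le]
  have hA : ∫ wp, partialP b g (skelFlowMapAt ω₂ lam β γ N T_L T_R s (max n m₁) z
      (pairRem (max n m₁) wp) (pairSkel (max n m₁) wp)) ∂wienerPair =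
      (∫ wp, g (skelFlowMapAt ω₂ lam β γ N T_L T_R s (max n m₁) z (pairRem (max n m₁) wp)
          (pairSkel (max n m₁) wp)) * skelWeightArr ω₂ lam β γ N T_L T_R s (max n m₁) ((n : ℝ) + 1)⁻¹
            b z (pairRem (max n m₁) wp) (pairSkel (max n m₁) wp) ∂wienerPair) +
      ∫ wp, ((n : ℝ) + 1)⁻¹ * fderiv ℝ g (skelFlowMapAt ω₂ lam β γ N T_L T_R s (max n m₁) z
        (pairRem (max n m₁) wp) (pairSkel (max n m₁) wp)) (ofCoordV N (skelCtrlArr ω₂ lam β γ N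
          T_L T_R s (max n m₁) ((n : ℝ) + 1)⁻¹ b z (pairRem (max n m₁) wp)
            (pairSkel (max n m₁) wp))) ∂wienerPair := by
    linarith [hId]
  rw [hA]
  exact (abs_add_le _ _).trans (add_le_add hHol (hDef.trans hLε))

/-! ## 3. The glue -/

omit hN hTL hTL' hTR hTR' in
include hω hl hβ hγ hT in
/-- ★★ **ARRIVAL GLUE** — (SWM) → (JMˣ)₂ → (I-s2)ₛ → (G1*ᶜᶜ) `PerturbedKernelMomentumIBPCompact`
for the chain with parameters `ω₂, lam, β, γ, T` ((JMˣ)₁ is T-a2's theorem `skeletonJacobianMoments`).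
[cite: CuneoEckmannHairerReyBellet2018, §3 eq. (3.4)] -/
theorem perturbedKernelMomentumIBPCompact_at (hW : SkeletonWeightMoments)
    (hJ2 : SkeletonSecondVariationMoments) (hI : SkeletonEventualSurjectivity) (hN2 : 2 ≤ N)
    {θ₁ θ₂ : ℝ} (hθ₁ : 0 < θ₁) (hθ₁₂ : θ₁ < θ₂) (hθ₂ : θ₂ < 1 / T) :
    ∃ b₀ δ₀ C : ℝ, b₀ < 1 ∧ 0 < δ₀ ∧ ∀ δ : ℝ, |δ| < δ₀ →
      ∀ s : ℝ, 0 < s → s ≤ 1 → ∀ b : Fin N, (b = leftBath N hN2 ∨ b = rightBath N hN2) →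
        ∀ M : ℝ, 0 ≤ M → ∀ g : PhaseSpace N → ℝ, ContDiff ℝ 1 g → HasCompactSupport g →
          (∀ w, |g w| ≤ M * Real.exp (θ₁ * (pinnedChain ω₂ lam β γ).hamiltonian N w)) →
          ∀ z : PhaseSpace N,
            |∫ w, partialP b g w ∂(pertKernel ω₂ lam β γ T δ N s z)| ≤
              C * s ^ (-b₀) * M * Real.exp (θ₂ * (pinnedChain ω₂ lam β γ).hamiltonian N z) := by
  have hN0 : 0 < N := by omega
  -- the temperature margin `δ₁` and `T* = T + δ₁/2` with `θ₁ T* < 1`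
  have hθ₁T : θ₁ * T < 1 := by
    have h1 : θ₁ < 1 / T := hθ₁₂.trans hθ₂
    rwa [lt_div_iff₀ hT] at h1
  have hδ₁ : 0 < min (T / 2) (1 / θ₁ - T) := by
    refine lt_min (half_pos hT) (sub_pos.2 ?_)
    rwa [lt_div_iff₀' hθ₁]  -- T < 1/θ₁ ↔ θ₁ * T < 1
  have hu : θ₁ * (T + min (T / 2) (1 / θ₁ - T) / 2) < 1 := by
    have h1 : min (T / 2) (1 / θ₁ - T) ≤ 1 / θ₁ - T := min_le_right _ _
    have h2 : θ₁ * (1 / θ₁) = 1 := mul_one_div_cancel hθ₁.ne'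
    nlinarith [h1, h2, hθ₁, hθ₁T]
  have hu0 : 0 < θ₁ * (T + min (T / 2) (1 / θ₁ - T) / 2) := mul_pos hθ₁ (by linarith)
  -- Hölder exponents `p = 1/a`, `q = 1/(1-a)`, `a = (1 + θ₁T*)/2`
  have ha0 : 0 < (1 + θ₁ * (T + min (T / 2) (1 / θ₁ - T) / 2)) / 2 := by linarith
  have ha1 : (1 + θ₁ * (T + min (T / 2) (1 / θ₁ - T) / 2)) / 2 < 1 := by linarith
  have hpq := Real.HolderConjugate.inv_one_sub_inv ha0 ha1
  have hp : 0 < ((1 + θ₁ * (T + min (T / 2) (1 / θ₁ - T) / 2)) / 2)⁻¹ := hpq.pos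
  have hq2 : 2 ≤ (1 - (1 + θ₁ * (T + min (T / 2) (1 / θ₁ - T) / 2)) / 2)⁻¹ := by
    rw [le_inv_comm₀ two_pos (by linarith)]
    linarith
  have hpθ : ((1 + θ₁ * (T + min (T / 2) (1 / θ₁ - T) / 2)) / 2)⁻¹ * θ₁ *
      (T + min (T / 2) (1 / θ₁ - T) / 2) < 1 := by
    rw [mul_assoc, inv_mul_lt_iff₀ ha0]
    linarith
  have hε : 0 < θ₂ - θ₁ := sub_pos.2 hθ₁₂
  obtain ⟨C, b₀, δ₀, hb₀, hδ₀, hArr, -⟩ := hW ω₂ lam β γ hω hl hβ hγ T hT N hN2 _ (θ₂ - θ₁) hq2 hε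
  refine ⟨b₀, min δ₀ (min (T / 2) (1 / θ₁ - T)),
    Real.exp (((1 + θ₁ * (T + min (T / 2) (1 / θ₁ - T) / 2)) / 2)⁻¹ * θ₁ * γ * (2 * T)) ^
      (((1 + θ₁ * (T + min (T / 2) (1 / θ₁ - T) / 2)) / 2)⁻¹)⁻¹ * |C|,
    hb₀, lt_min hδ₀ hδ₁, fun δ hδ s hs0 hs1 b hb M hM g hg hgc hgM z => ?_⟩
  have hδ' : |δ| < δ₀ := hδ.trans_le (min_le_left _ _)
  have hδ'' : |δ| < min (T / 2) (1 / θ₁ - T) := hδ.trans_le (min_le_right _ _)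
  have hδT : |δ| < T / 2 := hδ''.trans_le (min_le_left _ _)
  rw [abs_lt] at hδT hδ''
  have hs : s ∈ Icc (0 : ℝ) 1 := ⟨hs0.le, hs1⟩
  have hTL0 : 0 < T + δ / 2 := by linarith
  have hTR0 : 0 < T - δ / 2 := by linarith
  have hmax : max (T + δ / 2) (T - δ / 2) ≤ T + min (T / 2) (1 / θ₁ - T) / 2 :=
    max_le (by linarith) (by linarith)
  have hmax0 : 0 < max (T + δ / 2) (T - δ / 2) := lt_max_of_lt_left hTL0
  have hpθ' : ((1 + θ₁ * (T + min (T / 2) (1 / θ₁ - T) / 2)) / 2)⁻¹ * θ₁ <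
      1 / max (T + δ / 2) (T - δ / 2) := by
    rw [lt_div_iff₀ hmax0]
    exact lt_of_le_of_lt (mul_le_mul_of_nonneg_left hmax (mul_pos hp hθ₁).le) hpθ
  -- the two factors
  have h1 := fun m : ℕ => lintegral_rpow_abs_comp_skelFlowMapAt_le hω hl hβ hγ hN0 hTL0 hTR0 hθ₁ hp
    hpθ' hs m z hM hgM
  have h2 : ∀ κ : ℝ, 0 < κ → ∃ m₁ : ℕ, ∀ m : ℕ, m₁ ≤ m →
      skelMoment m (1 - (1 + θ₁ * (T + min (T / 2) (1 / θ₁ - T) / 2)) / 2)⁻¹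
        (skelWeightArr ω₂ lam β γ N (T + δ / 2) (T - δ / 2) s m κ b z) ≤
        ENNReal.ofReal ((|C| * (s ^ (-b₀) *
          Real.exp ((θ₂ - θ₁) * (pinnedChain ω₂ lam β γ).hamiltonian N z))) ^
            (1 - (1 + θ₁ * (T + min (T / 2) (1 / θ₁ - T) / 2)) / 2)⁻¹) := by
    intro κ hκ
    obtain ⟨m₁, hm₁⟩ := hArr δ hδ' s hs0 hs1 b hb z κ hκ
    refine ⟨m₁, fun m hm => (hm₁ m hm).trans ?_⟩
    rw [mul_assoc]
    exact ofReal_rpow_le_ofReal_abs_rpow C _ (mul_pos (Real.rpow_pos_of_pos hs0 _) (Real.exp_pos _)) _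
  have hsurj : ∀ wp : WienerPair, ∃ m₀ : ℕ, ∀ m, m₀ ≤ m → LinearMap.range
      (fderiv ℝ (skelFlowMapAt ω₂ lam β γ N (T + δ / 2) (T - δ / 2) s m z (pairRem m wp))
        (pairSkel m wp) : PairSkeleton m →ₗ[ℝ] PhaseSpace N) = ⊤ := fun wp =>
    hI ω₂ lam β γ hω hl hβ hγ N hN0 _ _ hTL0 hTR0 s hs0 hs1 z wp
  have hA₁ : 0 ≤ M * Real.exp (((1 + θ₁ * (T + min (T / 2) (1 / θ₁ - T) / 2)) / 2)⁻¹ * θ₁ * γ *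
      (T + δ / 2 + (T - δ / 2))) ^ (((1 + θ₁ * (T + min (T / 2) (1 / θ₁ - T) / 2)) / 2)⁻¹)⁻¹ *
        Real.exp (θ₁ * (pinnedChain ω₂ lam β γ).hamiltonian N z) :=
    mul_nonneg (mul_nonneg hM (Real.rpow_nonneg (Real.exp_pos _).le _)) (Real.exp_pos _).le
  have hA₂ : 0 ≤ |C| * (s ^ (-b₀) * Real.exp ((θ₂ - θ₁) * (pinnedChain ω₂ lam β γ).hamiltonian N z)) :=
    mul_nonneg (abs_nonneg _) (mul_pos (Real.rpow_pos_of_pos hs0 _) (Real.exp_pos _)).le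
  have hmain := abs_integral_partialP_comp_le hω hl hβ hγ hN0 hT (T_L := T + δ / 2)
    (T_R := T - δ / 2) (by linarith) (by linarith) (by linarith) (by linarith) hJ2 hpq hs b z hsurj
    hg hgc hA₁ hA₂ h1 h2 0
  rw [integral_partialP_pertKernel_eq hω hl.le hβ.le hγ.le N T δ hs 0 b z hg]
  refine hmain.trans (le_of_eq ?_)
  have hTT : T + δ / 2 + (T - δ / 2) = 2 * T := by ring
  have hexp : Real.exp (θ₁ * (pinnedChain ω₂ lam β γ).hamiltonian N z) *
      Real.exp ((θ₂ - θ₁) * (pinnedChain ω₂ lam β γ).hamiltonian N z) =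
      Real.exp (θ₂ * (pinnedChain ω₂ lam β γ).hamiltonian N z) := by
    rw [← Real.exp_add]
    congr 1
    ring
  rw [hTT, ← hexp]
  ring

end Arrival

/-- ★★★ **ARRIVAL GLUE, route form**: (SWM) → (JMˣ)₂ → (I-s2)ₛ → (G1*ᶜᶜ). [folklore] -/
theorem perturbedKernelMomentumIBPCompact_of_skeleton (hW : SkeletonWeightMoments)
    (hJ2 : SkeletonSecondVariationMoments) (hI : SkeletonEventualSurjectivity) :
    PerturbedKernelMomentumIBPCompact :=
  fun _ω₂ _lam _β _γ hω hl hβ hγ _T hT _N hN _θ₁ _θ₂ hθ₁ hθ₁₂ hθ₂ =>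
    perturbedKernelMomentumIBPCompact_at hω hl hβ hγ hT hW hJ2 hI hN hθ₁ hθ₁₂ hθ₂

end Summit.AtomisticToContinuum.FouriersLaw.Theorems.ExtensiveSnapshotIrreversibility.EnergyWindow

end
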